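import Summits.AtomisticToContinuum.Crystallization.Theorems.ThreeConeCertificateExactCertificateNoGapPeriodic

/-!
# `ExactCertificate` (stmt-AtomisticToContinuum-11959): the open stub `stub_noGap` in periodic-only form

Line `closure-makes-nogap-exact`, continuation lead c2 (registered stub `stub_noGapPeriodic`).

The line's open stub `stub_noGap` (↔ `SharpSplit`) quantifies, in its core clause, over ALL finite injective
configurations ("`Q` is an `ε`-approximate per-particle ground state of `g_f = (V_LJ − f)1_{(0,ρ₀)}` among all
finite configurations").  By `NoGap.stable_of_periodic_bound` (periodisation beyond the range) and core weak duality
(`Slackness.const_le_energyPerParticle_of_stable`) that clause is equivalent to its PERIODIC form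
"`e_{Q'}(g_f) ≥ e_Q(g_f) − ε` for every periodic `Q'`".  Hence:

**`stub_noGapPeriodic`.**  `stub_noGap ↔ ∃ ρ₀, ∀ ε > 0, ∃ Q f, f radially PD ∧ f ≤ V_LJ on [ρ₀,∞)∩(0,∞) ∧
(tail slack) f 0 + 2e_Q(f1_{(0,ρ₀)}) + 2e_Q(V_LJ 1_{[ρ₀,∞)}) ≤ ε ∧ (core, periodic) ∀ Q', e_Q(g_f) − ε ≤ e_{Q'}(g_f)`.

Every object in the open half of the crux is now a lattice sum over a periodic configuration.  All `[folklore]`.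
-/

noncomputable section

namespace Summit.AtomisticToContinuum.Crystallization.Theorems.ThreeConeCertificateExactCertificate.NoGap

open Literature.MathematicalPhysics.StatisticalMechanics
open Summit.AtomisticToContinuum.Crystallization.Theorems.ChargedEnergyGapNegative (E3)
open Summit.AtomisticToContinuum.Crystallization.Theorems.ThreeConeCertificateExactCertificate.Slackness
  (const_le_energyPerParticle_of_stable)
open scoped BigOperators

/-- **The core clause of `stub_noGap` is periodic**: for the finite-range `g_f = (V_LJ − f)1_{(0,ρ₀)}` and a
real `κ`, `κ·N ≤ E_{g_f}(x)` for all finite injective `x` iff `κ ≤ e_{Q'}(g_f)` for all periodic `Q'`. [folklore] -/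
theorem core_stable_iff_periodic (ρ₀ κ : ℝ) (f : ℝ → ℝ) :
    (∀ (N : ℕ) (x : Fin N → E3), Function.Injective x →
        κ * N ≤ interactionEnergy (fun r => if r < ρ₀ then lennardJones r - f r else 0) x) ↔
      ∀ Q' : PeriodicConfiguration 3,
        κ ≤ Q'.energyPerParticle (fun r => if r < ρ₀ then lennardJones r - f r else 0) := by
  have hW : ∀ r, ρ₀ ≤ r → (fun r => if r < ρ₀ then lennardJones r - f r else 0) r = 0 := fun r hr => by
    show (if r < ρ₀ then lennardJones r - f r else 0) = 0
    rw [if_neg (not_lt.2 hr)]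
  exact ⟨fun h Q' => const_le_energyPerParticle_of_stable Q' hW h,
    fun h N x hx => stable_of_periodic_bound hW h hx⟩

/-- **Registered stub `stub_noGapPeriodic` of crux item stmt-AtomisticToContinuum-11959 (line
`closure-makes-nogap-exact`; signature verbatim): the open stub `stub_noGap` in periodic-only form** — the core
clause over all finite configurations is replaced by its equivalent over periodic competitors. [folklore] -/
theorem stub_noGapPeriodic :
    (∃ ρ₀ : ℝ, ∀ ε : ℝ, 0 < ε → ∃ (Q : PeriodicConfiguration 3) (f : ℝ → ℝ),
      (∀ (n : ℕ) (y : Fin n → EuclideanSpace ℝ (Fin 3)) (w : Fin n → ℝ),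
        0 ≤ ∑ i, ∑ j, w i * w j * f (dist (y i) (y j))) ∧
      (∀ r : ℝ, ρ₀ ≤ r → 0 < r → f r ≤ lennardJones r) ∧
      f 0 + 2 * Q.energyPerParticle (fun r => if r < ρ₀ then f r else 0) +
          2 * Q.energyPerParticle (fun r => if r < ρ₀ then 0 else lennardJones r) ≤ ε ∧
      (∀ (N : ℕ) (x : Fin N → EuclideanSpace ℝ (Fin 3)), Function.Injective x →
        (N : ℝ) * (Q.energyPerParticle (fun r => if r < ρ₀ then lennardJones r - f r else 0) - ε) ≤
          interactionEnergy (fun r => if r < ρ₀ then lennardJones r - f r else 0) x)) ↔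
    (∃ ρ₀ : ℝ, ∀ ε : ℝ, 0 < ε → ∃ (Q : PeriodicConfiguration 3) (f : ℝ → ℝ),
      (∀ (n : ℕ) (y : Fin n → EuclideanSpace ℝ (Fin 3)) (w : Fin n → ℝ),
        0 ≤ ∑ i, ∑ j, w i * w j * f (dist (y i) (y j))) ∧
      (∀ r : ℝ, ρ₀ ≤ r → 0 < r → f r ≤ lennardJones r) ∧
      f 0 + 2 * Q.energyPerParticle (fun r => if r < ρ₀ then f r else 0) +
          2 * Q.energyPerParticle (fun r => if r < ρ₀ then 0 else lennardJones r) ≤ ε ∧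
      ∀ Q' : PeriodicConfiguration 3,
        Q.energyPerParticle (fun r => if r < ρ₀ then lennardJones r - f r else 0) - ε ≤
          Q'.energyPerParticle (fun r => if r < ρ₀ then lennardJones r - f r else 0)) := by
  refine exists_congr fun ρ₀ => forall_congr' fun ε => imp_congr_right fun _ =>
    exists_congr fun Q => exists_congr fun f => and_congr_right fun _ => and_congr_right fun _ =>
      and_congr_right fun _ => ?_
  rw [← core_stable_iff_periodic ρ₀ _ f]
  refine forall_congr' fun N => forall_congr' fun x => imp_congr_right fun _ => ?_
  rw [mul_comm]

end Summit.AtomisticToContinuum.Crystallization.Theorems.ThreeConeCertificateExactCertificate.NoGap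

end
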